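import Summits.RiemannHypothesis.RiemannHypothesis.Theorems.HandoffDodgerSmallCeiling
import Summits.RiemannHypothesis.RiemannHypothesis.Theorems.HandoffDodgerSlabHorizon
import Summits.RiemannHypothesis.RiemannHypothesis.Theorems.HandoffDodgerSlabProfile
import Summits.RiemannHypothesis.RiemannHypothesis.Theorems.HandoffDodgerSlabWindow
import Summits.RiemannHypothesis.RiemannHypothesis.Theorems.HandoffDodgerSlabCost
import Summits.RiemannHypothesis.RiemannHypothesis.Theorems.HandoffDodgerSlabPhi
import HarnessLib

/-!
# HANDOFF — SLAB THRESHOLD (6): THE RH-FREE WALL CEILING AND THE UPPER CLAUSE FROM `q₀ = 30000` (rh-explicit, D-0040 WEIL column prover seat handoff-prove-2 gen13, ATTEMPT-23)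

RH-FREE. HONEST FRAMING: nothing here bears on the truth of RH; every statement is an UPPER bound on the wall offsets
`δ*(q) = a*(S_q) − (log q)/2` or an upper clause `a*(S_q) < (log q')/2` (RH is the LOWER clause `∀ q, 0 ≤ δ*(q)`, not touched).

gen11's `HandoffDodgerSmallCeiling.subwindowZeroSumFamily_sixtyThousand` assembled the mollified zero-dodger at the schedule
`y = 2L^{3/2}`, `N₁ = ⌈13L/2⌉` for every prime `q ≥ 60000`.  On the SLAB `30000 ≤ q < 60000` the threshold-free theorem
`HandoffDodgerExplicit.dodger_witness_explicit` is re-assembled here at the CONSTANT schedule `y = 76`, `N₁ = 70`, `n = q³`,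
`C = 1/5`, `b = L/2 − ε`, whose hypotheses hold there by parts (1)–(5) (`HandoffDodgerSlab{Horizon,Profile,Window,Cost,Phi}`:
`κ ≥ 1/4`, cost `≤ 2360(b+1.84)e^{−2b}` < gain `≥ (9/2000)Φ(812.25)²e^{−4b}`).  Glued with the `q ≥ 60000` family:
* `subwindowZeroSumFamily_thirtyThousand : SubwindowZeroSumFamily (1/5) 30000`;
* `dodgerWallCeiling_thirtyThousand : DodgerWallCeiling (1/5) 30000`;
* **`upperClause_from_thirtyThousand`** — the UPPER CLAUSE `a*(S_q) < (log q⁺)/2` for EVERY prime `q ≥ 30000`, GAP-BLIND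
  (in particular at the 346 lower-twin primes `30000 ≤ q < 60000` of the WEIL route's wall `WallsSixtyKTwin`, stmt 19185);
* `classLaw_from_thirtyThousand` (the `∀ q' > q` currency) and `semilocalClassLawTail_iff_range_thirtyThousand`
  (the WEIL route's crux C-I(a)-tail ⟺ the upper clause at the primes `80 ≤ q < 30000`).
No `sorry`, standard axioms; every ingredient is a theorem of this track or of Mathlib.

References: this track (ATTEMPT-16 THEOREMS 16.1–16.2, ATTEMPT-19 §7–§8, ATTEMPT-21 §1–§7, ATTEMPT-23 §1–§3).
-/

set_option linter.dupNamespace false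

noncomputable section

open Real Complex Set MeasureTheory Literature.NumberTheory.LFunctions Literature.NumberTheory.LFunctions.WeilContinuous

namespace Summit.RiemannHypothesis.RiemannHypothesis.Theorems.Handoff

open Summit.RiemannHypothesis.RiemannHypothesis.Theorems.MotivicDoor.SemilocalThreshold
open Summit.RiemannHypothesis.RiemannHypothesis.Theorems.HandoffDecomposition (nextPrime nextPrime_prime lt_nextPrime nextPrime_le consecutivePrimes_nextPrime)
open Summit.RiemannHypothesis.RiemannHypothesis.Theorems.SemilocalClassLaw

set_option maxHeartbeats 400000 in
/-- **THEOREM (the RH-free zero-sum family at rate `(1/5)(log q)^{3/2}q^{−3/2}` on the SLAB `30000 ≤ q < 60000`).**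
[this track, ATTEMPT-16 THEOREM 16.2; ATTEMPT-23 §2] -/
theorem subwindowZeroSum_slab {q q' : ℕ} (hqq' : ConsecutivePrimes q q') (hq₀ : 30000 ≤ q) (hq₁ : q < 60000) :
    ∃ θ : ℝ → ℂ, ∃ δ B : ℝ, IsWeilTest θ ∧ tsupport θ ⊆ Icc (-(Real.log q / 2)) (Real.log q / 2) ∧ 0 ≤ δ ∧
      δ ≤ 1 / 5 * Real.log q ^ (3 / 2 : ℝ) * (q : ℝ) ^ (-(3 / 2 : ℝ)) ∧ Real.log q / 2 + δ ≤ Real.log q' / 2 ∧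
      (∀ U : ℝ, ∑ᶠ ρ ∈ weilZeroIndex U,
          (riemannZetaZeroOrder ρ : ℝ) * ‖weilMellin (fun x ↦ θ (x - δ) - θ (x + δ)) ρ‖ ^ 2 ≤ B) ∧
      B < 2 * Real.log q / Real.sqrt q * (weilConv θ (weilReflect θ) (Real.log q - 2 * δ)).re := by
  obtain ⟨hqprime, -, hqq, -⟩ := hqq'
  have hq2 : 2 ≤ q := hqprime.two_le
  have hq0 : (0 : ℝ) < q := by exact_mod_cast hqprime.pos
  -- the mollifier radius `r = 1/(q³+1)`, a generic `ε ∈ [r, 2r]`, the half-width `b = L/2 − ε`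
  have hr : (bump (q ^ 3)).rOut = 1 / ((q : ℝ) ^ 3 + 1) := by rw [bump_rOut]; push_cast; ring
  have hr0 : 0 < (bump (q ^ 3)).rOut := (bump (q ^ 3)).rOut_pos
  obtain ⟨ε, ⟨hε1, hε2⟩, hgen⟩ := exists_generic_shift (Real.log q) hr0
  set b : ℝ := Real.log q / 2 - ε with hb
  have hbq1 : b + (bump (q ^ 3)).rOut ≤ Real.log q / 2 := by linarith
  have hbq2 : Real.log q / 2 ≤ b + 2 * (bump (q ^ 3)).rOut := by linarith
  -- part (3), radius: `29999 ≤ e^{2b} ≤ 60000`, `2b ≤ L`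
  obtain ⟨-, -, -, -, -, he, he', hL1, -, -⟩ := radius_facts_slab hq₀ hq₁ rfl hr hbq1 hbq2
  obtain ⟨hb0, hb1'⟩ := slab_b_bounds he he'
  have hb1 : 1 ≤ b := by linarith
  -- part (1): the horizon
  obtain ⟨hside1, hside2⟩ := slab_horizon_side_conditions he he'
  obtain ⟨hA, hB, hT3, hk2, hℓ2, hK1, -⟩ := slab_horizon_index_bounds he he'
  obtain ⟨h101, hT'T₀, -, hTbig, -, hcI, hcI2, hcL, hpL, hpU0, hpU, hW1, -, hW3, hk2', hk04, hTe⟩ :=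
    slab_horizon_sizes_B he he'
  have hTT₀ : π * (dodgerKprime b : ℝ) / b ≤ 2 * π * Real.exp (1 + 2 * b) := hT'T₀
  have hT₀T : 2 * π * Real.exp (1 + 2 * b) ≤ 101 / 100 * (π * (dodgerKprime b : ℝ) / b) := h101
  have hp : 0 < dodgerPL b := lt_of_lt_of_le (by have := Real.pi_pos; positivity) hpL
  -- part (3): the window conditions
  obtain ⟨-, ⟨hδU0, hδU1, hδb⟩, ⟨hr600, hr6⟩, hδC, hwin, ⟨hQ0, hQ⟩⟩ :=
    window_conditions_slab (T := π * (dodgerKprime b : ℝ) / b) (pL := dodgerPL b) (pU := dodgerPU b)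
      (y := 76) hq₀ hq₁ rfl hr hbq1 hbq2 hTT₀ hT₀T hpL hpU0 hpU rfl rfl rfl
  -- part (2): the profile-control constants
  obtain ⟨hN, hρ11, hρ2e, hκ⟩ :=
    profile_constants_slab (T := π * (dodgerKprime b : ℝ) / b) (k := (dodgerKprime b : ℝ)) (pL := dodgerPL b) (W := dodgerW b)
      (y := 76) (N₁ := 70) hb1' hTbig hW1 hW3 hk2' hk04 hpL rfl rfl rfl rfl rfl rfl rfl rfl rfl
  -- part (5): the profile value
  have hΦ := profile_value_slab hb0 hb1' he' (rfl : (76 : ℝ) = 76)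
    (summable_dodgerPhiTerm (9 * (76 : ℝ) ^ 2 / 64)).hasSum
  -- part (4): the comparison
  have hlt := cost_lt_gain_slab (cI := dodgerCI b) (r := (bump (q ^ 3)).rOut) hb0 hb1' he hL1 hTe hTT₀ hk2' hk04 hcI hcI2
    rfl rfl hδU0 hδU1 hQ0 hQ hκ hr600 rfl rfl hpU0 hpU (dodgerPhi_pos (by positivity)).le le_rfl hΦ
  -- the genericity of the lattice
  have hgen' : ∀ ρ : ℂ, riemannZeta ρ = 0 → 0 < ρ.im →
      ∀ k ∈ Finset.range (zetaZeroCount (π * (dodgerKprime b : ℝ) / b)), dodgerNode ρ - latticeFreq b (k + 1) ≠ 0 := by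
    intro ρ hζ hρ k _
    have h := hgen ρ hζ hρ.ne' k
    rw [sub_ne_zero]
    simpa [dodgerNode, latticeFreq] using h
  -- the explicit dodger
  exact dodger_witness_explicit (q := q) (q' := q') (b := b) (T₀ := dodgerT₀ b)
    (y := 76) (C := 1 / 5) (n := q ^ 3) (k' := dodgerKprime b)
    (N₁ := 70) hb1 rfl hside1 hside2 hA hB hT3 hk2 hℓ2 hK1 rfl rfl rfl rfl rfl rfl (by norm_num)
    rfl rfl rfl rfl rfl rfl rfl rfl rfl hcL hp hN hρ11 hρ2e (le_trans (by norm_num) hκ) hδb hr6 hδC (hwin q' (by omega)) hbq1 hbq2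
    hgen' hlt

/-- **THEOREM (the RH-free zero-sum family at rate `(1/5)(log q)^{3/2}q^{−3/2}` from `q₀ = 30000` on)** — the slab glued with
gen11's family from `60000`. [this track, ATTEMPT-16 THEOREM 16.2; ATTEMPT-21 §7; ATTEMPT-23 §2] -/
theorem subwindowZeroSumFamily_thirtyThousand : SubwindowZeroSumFamily (1 / 5) 30000 := by
  intro q q' hqq' hq₀
  rcases Nat.lt_or_ge q 60000 with hlt | hge
  · exact subwindowZeroSum_slab hqq' hq₀ hlt
  · exact subwindowZeroSumFamily_sixtyThousand q q' hqq' hge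

/-- **COROLLARY (the Dodger wall ceiling from `30000`, RH-free).** `∀ primes q ≥ 30000, δ*(q) ≤ (1/5)(log q)^{3/2} q^{−3/2}`.
[this track, ATTEMPT-23 §2] -/
theorem dodgerWallCeiling_thirtyThousand : DodgerWallCeiling (1 / 5) 30000 :=
  dodgerWallCeiling_of_zeroSumFamily subwindowZeroSumFamily_thirtyThousand

/-- **COROLLARY (the RH-free UPPER CLAUSE from `q₀ = 30000`, GAP-BLIND).** For every prime `q ≥ 30000`:
`a*(S_{<q}) < (log q⁺)/2`, `q⁺` the next prime — in particular at every lower-twin prime `30000 ≤ q < 60000` of the WEIL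
route's wall `WallsSixtyKTwin` (no hypothesis on the prime gap). [this track, ATTEMPT-23 §2] -/
theorem upperClause_from_thirtyThousand {q : ℕ} (hq : q.Prime) (hq₀ : 30000 ≤ q) :
    weilSemilocalThreshold (Nat.primesBelow q) < Real.log (nextPrime q) / 2 := by
  have hqq' := consecutivePrimes_nextPrime hq
  obtain ⟨θ, δ, hθ, hθs, hδ, -, hwin, hneg⟩ :=
    subwindowWitnessFamily_of_zeroSumFamily subwindowZeroSumFamily_thirtyThousand q (nextPrime q) hqq' hq₀
  have h := wallOffset_lt_of_translatePair hqq' hθ hθs hδ hwin hneg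
  simp only [HandoffMarginLaw.wallOffset] at h
  linarith

/-- C-I(a) at every prime `q ≥ 30000`, in the `∀ q' > q` currency of the WEIL route's leaf — this IS the sentence of
`WallsSixtyKTwin` / `WallsSixtyKNonTwin` (stmts 19185/19186) at every prime `q ≥ 30000`, twin or not. [this track, ATTEMPT-23 §2] -/
theorem classLaw_from_thirtyThousand {q : ℕ} (hq : q.Prime) (hq₀ : 30000 ≤ q) :
    ∀ q' : ℕ, q'.Prime → q < q' → weilSemilocalThreshold (Nat.primesBelow q) < Real.log q' / 2 :=
  forall_prime_gt_lt_iff_upperClause.2 (upperClause_from_thirtyThousand hq hq₀)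

/-- **THE WEIL ROUTE'S CRUX REDUCED TO `q < 30000` (RH-free bookkeeping).** `SemilocalClassLawTail` (C-I(a) for all primes
`q ≥ 80`) holds iff the upper clause holds at the primes `80 ≤ q < 30000`. [this track, ATTEMPT-23 §2] -/
theorem semilocalClassLawTail_iff_range_thirtyThousand :
    SemilocalClassLawTail ↔
      ∀ q : ℕ, q.Prime → 80 ≤ q → q < 30000 →
        weilSemilocalThreshold (Nat.primesBelow q) < Real.log (nextPrime q) / 2 := by
  rw [semilocalClassLawTail_iff_forall_upperClause]
  refine ⟨fun h q hq h80 _ ↦ h q hq h80, fun h q hq h80 ↦ ?_⟩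
  rcases Nat.lt_or_ge q 30000 with hlt | hge
  · exact h q hq h80 hlt
  · exact upperClause_from_thirtyThousand hq hge

/-- The whole leaf likewise: `SemilocalClassLawAll` iff the upper clause at every prime `q < 30000`. [this track, ATTEMPT-23 §2] -/
theorem semilocalClassLawAll_iff_upperClause_range_thirtyThousand :
    SemilocalClassLawAll ↔
      ∀ q : ℕ, q.Prime → q < 30000 → weilSemilocalThreshold (Nat.primesBelow q) < Real.log (nextPrime q) / 2 := by
  rw [semilocalClassLawAll_iff_forall_upperClause]
  refine ⟨fun h q hq _ ↦ h q hq, fun h q hq ↦ ?_⟩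
  rcases Nat.lt_or_ge q 30000 with hlt | hge
  · exact h q hq hlt
  · exact upperClause_from_thirtyThousand hq hge

end Summit.RiemannHypothesis.RiemannHypothesis.Theorems.Handoff

end
-- 2026-08-26T15:1xZ: byte-identical re-land to re-enqueue the stranded hub olean (accepted as p443333, not built after 60 min; ops-buildfix recipe); no content change.
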